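import Summits.AtomisticToContinuum.BoseEinsteinCondensation.Theorems.BECHeatBathGapJastrowDobrushinRungGap
import Literature.MathematicalPhysics.QuantumManyBody.LiebYngvasonBoxBound

/-!
# Route `BECHeatBathGap` — support item `JastrowDobrushinRung` (stmt-AtomisticToContinuum-14373):
# the Jastrow model on `Λ_L^N`, part 1: weights and their factorisation (helper file 6)

Helpers for the proof of
`Summit.AtomisticToContinuum.BoseEinsteinCondensation.Theses.BECHeatBathGap.JastrowDobrushinRung`
(approximate tensorisation of variance with constant 2 for the Jastrow law under
`5N∫(1-f²) ≤ L³`, via Dobrushin uniqueness ⇒ heat-bath spectral gap ≥ 1 - r, Wu 2006, re-proved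
from scratch). As in helper file 1, the operators `S` (one-site average), `T` (heat bath),
`P = N⁻¹∑T_j` (random-scan Gibbs sampler) and the weights `w = B_j π_j` are variables with
defining hypotheses `hS, hT, hP, hw, …` (no auxiliary definitions).

This file: `1 - ∏ g ≤ ∑ (1-g)`, the normalised box measure `u = L⁻³·Leb|_{Λ_L}` is a probability
measure, the deficit bounds `∫(1 - f(x-z)²)du(z), ∫(1 - f(z-x)²)du(z) ≤ β = ∫_{ℝ³}(1-f²)/L³`
(translation invariance), the combinatorial factorisation `w = B_j π_j` of the pair weight
`w = ∏_{i<l} f(x_i-x_l)²` with `π_j = ∏_{k≠j} f(±(x_j-x_k))²` (`w_eq_B_mul_pi`), and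
measurability/bounds/invariance of `π_j`, `B_j` (`model_hπ`, `model_hB`).
-/

noncomputable section

namespace Summit.AtomisticToContinuum.BoseEinsteinCondensation.Theorems

namespace JastrowDobrushin

open MeasureTheory Function
open scoped ENNReal

variable {ι : Type*} [DecidableEq ι] {E : Type*} [MeasurableSpace E]
  {u : Measure E} {S : ι → ((ι → E) → ℝ) → (ι → E) → ℝ}

/-! ### The Jastrow model: `w = ∏_{i<l} f(x_i - x_l)²` on `Λ_L^N` -/

section Model

open Literature.MathematicalPhysics.QuantumManyBody.BoseGas

omit [DecidableEq ι] [MeasurableSpace E] in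
/-- `1 - ∏ g_k ≤ ∑ (1 - g_k)` for `g_k ∈ [0, 1]`. [folklore] -/
theorem one_sub_prod_le_sum {κ : Type*} (s : Finset κ) (g : κ → ℝ)
    (h : ∀ k ∈ s, 0 ≤ g k ∧ g k ≤ 1) : 1 - ∏ k ∈ s, g k ≤ ∑ k ∈ s, (1 - g k) := by
  classical
  induction s using Finset.induction_on with
  | empty => simp
  | insert a s ha ih =>
    have hs : ∀ k ∈ s, 0 ≤ g k ∧ g k ≤ 1 := fun k hk => h k (Finset.mem_insert_of_mem hk)
    have hP1 : ∏ k ∈ s, g k ≤ 1 := Finset.prod_le_one (fun k hk => (hs k hk).1) fun k hk => (hs k hk).2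
    have ha' := h a (Finset.mem_insert_self a s)
    rw [Finset.prod_insert ha, Finset.sum_insert ha]
    have : 1 - g a * ∏ k ∈ s, g k = (1 - g a) + g a * (1 - ∏ k ∈ s, g k) := by ring
    rw [this]
    exact add_le_add le_rfl ((mul_le_of_le_one_left (by linarith) ha'.2).trans (ih hs))

variable {N : ℕ} {L : ℝ} {f : Space → ℝ}

/-- The normalised Lebesgue measure on the box `Λ_L` is a probability measure. [folklore] -/
theorem isProbabilityMeasure_boxMeasure (hL : 0 < L) :
    IsProbabilityMeasure ((ENNReal.ofReal (L ^ 3))⁻¹ • (volume.restrict (box L) : Measure Space)) := by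
  constructor
  rw [Measure.smul_apply, Measure.restrict_apply_univ, volume_box, ← ENNReal.ofReal_pow hL.le,
    smul_eq_mul, ENNReal.inv_mul_cancel]
  · exact (ENNReal.ofReal_pos.mpr (by positivity)).ne'
  · exact ENNReal.ofReal_ne_top

/-- Mean over the box of a nonnegative integrable function is at most its total integral
divided by `L³`. [folklore] -/
theorem integral_boxMeasure_le (hL : 0 < L) {g : Space → ℝ} (hg : Integrable g)
    (hg0 : ∀ z, 0 ≤ g z) :
    ∫ z, g z ∂((ENNReal.ofReal (L ^ 3))⁻¹ • (volume.restrict (box L) : Measure Space)) ≤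
      (∫ z, g z) / L ^ 3 := by
  rw [integral_smul_measure, ENNReal.toReal_inv, ENNReal.toReal_ofReal (by positivity),
    smul_eq_mul, div_eq_inv_mul]
  exact mul_le_mul_of_nonneg_left (setIntegral_le_integral hg (ae_of_all _ hg0))
    (by positivity)

/-- The one-particle deficits `∫ (1 - f(x - z)²) du(z)`, `∫ (1 - f(z - x)²) du(z)` over the
normalised box are at most `β = ∫_{ℝ³} (1 - f²) / L³`, uniformly in `x ∈ ℝ³` (translation
invariance of Lebesgue measure). [folklore] -/
theorem deficit_le (hL : 0 < L) (hf01 : ∀ x, 0 ≤ f x ∧ f x ≤ 1)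
    (hI : Integrable (fun x => 1 - f x ^ 2)) (x : Space) :
    ∫ z, (1 - f (x - z) ^ 2) ∂((ENNReal.ofReal (L ^ 3))⁻¹ • (volume.restrict (box L) : Measure Space))
        ≤ (∫ y, (1 - f y ^ 2)) / L ^ 3 ∧
      ∫ z, (1 - f (z - x) ^ 2) ∂((ENNReal.ofReal (L ^ 3))⁻¹ • (volume.restrict (box L) : Measure Space))
        ≤ (∫ y, (1 - f y ^ 2)) / L ^ 3 := by
  have h0 : ∀ y, 0 ≤ 1 - f y ^ 2 := fun y => by
    have := hf01 y; nlinarith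
  constructor
  · have h1 := integral_boxMeasure_le hL (hI.comp_sub_left x) (fun z => h0 _)
    rwa [integral_sub_left_eq_self (fun y => 1 - f y ^ 2) volume x] at h1
  · have h1 := integral_boxMeasure_le hL (hI.comp_sub_right x) (fun z => h0 _)
    rwa [integral_sub_right_eq_self (μ := volume) (fun y => 1 - f y ^ 2) x] at h1


/-! #### The one-site weight `π_j = ∏_{k ≠ j} f(±(x_j - x_k))²` and its complement `B_j` -/

variable {πN BN : Fin N → (Fin N → Space) → ℝ} {wN : (Fin N → Space) → ℝ}

/-- Combinatorial heart of the factorisation `w = B_j π_j`: the pair factors containing `j`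
are exactly the factors `f(±(x_j - x_k))²`, `k ≠ j`. [folklore] -/
theorem prod_prod_ite_eq_prod_erase (T : Fin N → Fin N → ℝ) (j : Fin N) :
    ∏ i, ∏ l ∈ Finset.univ.filter (fun l => i < l), (if i = j ∨ l = j then T i l else 1) =
      ∏ k ∈ Finset.univ.erase j, (if k < j then T k j else T j k) := by
  -- split the outer product at `i = j`
  rw [← Finset.mul_prod_erase Finset.univ _ (Finset.mem_univ j)]
  have h1 : ∏ l ∈ Finset.univ.filter (fun l => j < l), (if j = j ∨ l = j then T j l else 1) =
      ∏ l ∈ Finset.univ.filter (fun l => j < l), T j l :=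
    Finset.prod_congr rfl fun l _ => if_pos (Or.inl rfl)
  have h2 : ∀ i ∈ Finset.univ.erase j,
      ∏ l ∈ Finset.univ.filter (fun l => i < l), (if i = j ∨ l = j then T i l else 1) =
        if i < j then T i j else 1 := by
    intro i hi
    have hij : i ≠ j := Finset.ne_of_mem_erase hi
    have : ∀ l, (i = j ∨ l = j) = (l = j) := fun l => by simp [hij]
    simp_rw [this]
    rw [Finset.prod_ite_eq']
    simp
  rw [h1, Finset.prod_congr rfl h2]
  -- right-hand side: split the `ite` into two products
  have h3 : ∀ k ∈ Finset.univ.erase j, (if k < j then T k j else T j k) =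
      (if k < j then T k j else 1) * (if k < j then 1 else T j k) := fun k _ => by
    split_ifs <;> simp
  rw [Finset.prod_congr rfl h3, Finset.prod_mul_distrib, mul_comm]
  congr 1
  -- `∏_{l > j} T j l = ∏_{k ≠ j} (if k < j then 1 else T j k)`
  have h4 : ∀ k ∈ Finset.univ.erase j, (if k < j then (1 : ℝ) else T j k) =
      if j < k then T j k else 1 := by
    intro k hk
    have hkj : k ≠ j := Finset.ne_of_mem_erase hk
    by_cases h : k < j
    · rw [if_pos h, if_neg (not_lt.mpr h.le)]
    · rw [if_neg h, if_pos (lt_of_le_of_ne (not_lt.mp h) hkj.symm)]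
  rw [Finset.prod_congr rfl h4, ← Finset.prod_filter, Finset.filter_erase,
    Finset.erase_eq_of_notMem (by simp)]

/-- The pair weight `w = ∏_{i<l} f(x_i-x_l)²` factorises as `w = B_j π_j`. [folklore] -/
theorem w_eq_B_mul_pi
    (hπN : ∀ j X, πN j X = ∏ k ∈ Finset.univ.erase j,
      (if k < j then f (X k - X j) ^ 2 else f (X j - X k) ^ 2))
    (hBN : ∀ j X, BN j X = ∏ i, ∏ l ∈ Finset.univ.filter (fun l => i < l),
      (if i = j ∨ l = j then 1 else f (X i - X l) ^ 2))
    (hwN : ∀ X, wN X = ∏ i, ∏ l ∈ Finset.univ.filter (fun l => i < l), f (X i - X l) ^ 2)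
    (j : Fin N) (X : Fin N → Space) : wN X = BN j X * πN j X := by
  rw [hwN, hBN, hπN, ← prod_prod_ite_eq_prod_erase (fun i l => f (X i - X l) ^ 2) j,
    ← Finset.prod_mul_distrib]
  refine Finset.prod_congr rfl fun i _ => ?_
  rw [← Finset.prod_mul_distrib]
  refine Finset.prod_congr rfl fun l _ => ?_
  split_ifs <;> simp

/-- Measurability of a pair factor `X ↦ f(X i - X l)²`. [folklore] -/
theorem measurable_pairFactor (hf : Measurable f) (i l : Fin N) :
    Measurable fun X : Fin N → Space => f (X i - X l) ^ 2 :=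
  (hf.comp ((measurable_pi_apply i).sub (measurable_pi_apply l))).pow_const 2

/-- The one-site weight `π_j` is measurable with values in `[0, 1]`. [folklore] -/
theorem model_hπ (hf : Measurable f) (hf01 : ∀ x, 0 ≤ f x ∧ f x ≤ 1)
    (hπN : ∀ j X, πN j X = ∏ k ∈ Finset.univ.erase j,
      (if k < j then f (X k - X j) ^ 2 else f (X j - X k) ^ 2)) (j : Fin N) :
    Measurable (πN j) ∧ ∀ X, 0 ≤ πN j X ∧ πN j X ≤ 1 := by
  have hsq : ∀ x, 0 ≤ f x ^ 2 ∧ f x ^ 2 ≤ 1 := fun x =>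
    ⟨sq_nonneg _, pow_le_one₀ (hf01 x).1 (hf01 x).2⟩
  have hdef : πN j = fun X => ∏ k ∈ Finset.univ.erase j,
      (if k < j then f (X k - X j) ^ 2 else f (X j - X k) ^ 2) := funext (hπN j)
  refine ⟨?_, fun X => ?_⟩
  · rw [hdef]
    refine Finset.measurable_prod _ fun k _ => ?_
    by_cases h : k < j
    · simp only [h, ↓reduceIte]; exact measurable_pairFactor hf k j
    · simp only [h, ↓reduceIte]; exact measurable_pairFactor hf j k
  · rw [hπN]
    refine ⟨Finset.prod_nonneg fun k _ => ?_, Finset.prod_le_one (fun k _ => ?_) fun k _ => ?_⟩ <;>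
      split_ifs <;> simp [hsq]

/-- The complementary weight `B_j` (pairs avoiding `j`) is measurable, `[0,1]`-valued and does
not depend on `x_j`. [folklore] -/
theorem model_hB (hf : Measurable f) (hf01 : ∀ x, 0 ≤ f x ∧ f x ≤ 1)
    (hBN : ∀ j X, BN j X = ∏ i, ∏ l ∈ Finset.univ.filter (fun l => i < l),
      (if i = j ∨ l = j then 1 else f (X i - X l) ^ 2)) (j : Fin N) :
    Measurable (BN j) ∧ (∀ X, 0 ≤ BN j X ∧ BN j X ≤ 1) ∧
      ∀ X y, BN j (update X j y) = BN j X := by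
  have hsq : ∀ x, 0 ≤ f x ^ 2 ∧ f x ^ 2 ≤ 1 := fun x =>
    ⟨sq_nonneg _, pow_le_one₀ (hf01 x).1 (hf01 x).2⟩
  have hdef : BN j = fun X => ∏ i, ∏ l ∈ Finset.univ.filter (fun l => i < l),
      (if i = j ∨ l = j then 1 else f (X i - X l) ^ 2) := funext (hBN j)
  refine ⟨?_, fun X => ?_, fun X y => ?_⟩
  · rw [hdef]
    refine Finset.measurable_prod _ fun i _ => Finset.measurable_prod _ fun l _ => ?_
    by_cases h : i = j ∨ l = j
    · simp only [h, ↓reduceIte]; exact measurable_const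
    · simp only [h, ↓reduceIte]; exact measurable_pairFactor hf i l
  · rw [hBN]
    refine ⟨Finset.prod_nonneg fun i _ => Finset.prod_nonneg fun l _ => ?_,
      Finset.prod_le_one (fun i _ => Finset.prod_nonneg fun l _ => ?_)
        fun i _ => Finset.prod_le_one (fun l _ => ?_) fun l _ => ?_⟩ <;>
      split_ifs <;> simp [hsq]
  · rw [hBN, hBN]
    refine Finset.prod_congr rfl fun i _ => Finset.prod_congr rfl fun l _ => ?_
    by_cases h : i = j ∨ l = j
    · rw [if_pos h, if_pos h]
    · rw [if_neg h, if_neg h]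
      rw [not_or] at h
      rw [update_of_ne h.1, update_of_ne h.2]


/-- The section of `π_j` along the `j`-th fibre. [folklore] -/
theorem pi_update_eq
    (hπN : ∀ j X, πN j X = ∏ k ∈ Finset.univ.erase j,
      (if k < j then f (X k - X j) ^ 2 else f (X j - X k) ^ 2))
    (j : Fin N) (Y : Fin N → Space) (z : Space) :
    πN j (update Y j z) =
      ∏ k ∈ Finset.univ.erase j, (if k < j then f (Y k - z) ^ 2 else f (z - Y k) ^ 2) := by
  rw [hπN]
  refine Finset.prod_congr rfl fun k hk => ?_
  rw [update_self, update_of_ne (Finset.ne_of_mem_erase hk)]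

end Model

end JastrowDobrushin

end Summit.AtomisticToContinuum.BoseEinsteinCondensation.Theorems
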